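import Mathlib
import Summits.Ventures.FusionMHD.Models.CerfonFreidbergIterLikeQ25Defs
import HarnessLib

/-!
# Ventures/FusionMHD — Models/CerfonFreidbergIterLikeQ25Panels10.lean: KERNEL CHECK of panels 21, 22 (of 32) of the
# certified safety factor `q(ψ_N = 1/4)/F` of THE Cerfon–Freidberg ITER-like instance (sibling of `…IterLikeQHalfPanels*.lean`)

HONEST FRAMING (LADDER-GRIDFUSION three columns; CF rung, F2 item R2, q-profile sample).  One `decide +kernel` (≈ 60 s on the farm): for
each panel `j` listed, the per-panel obligation `CFIterLike.Q25.PanelCert.ok` (`Models/CerfonFreidbergIterLikeQ25Defs.lean`) — the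
Taylor-model run of `CFIterLike.Q25.progG` over the ITER-like parameter box is ACCEPTED (every `log`/`sin`/`cos` composition and the `inv`
certificate), and the kernel's panel-integral enclosure of the polar `(6.35)` integrand along the approximant, the range of the flux residual
`U(ray m) − 3U_a/4`, the range of the approximant `m` and the range of the radial derivative `D_r(θ, m)` lie inside the integers claimed in
`panelCert10` (values read off a compiled `#eval` of the same functions, slack one unit of `2⁻⁶⁰`; probe `QProbeIF*.lean`, generator
`pub/gridfusion/models/gen-model-5/g8/gen90/mkdefsN.py`).  What these Booleans MEAN (real-number statements, uniformly over the parameter box ∋ THE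
ITER-like instance) is proved once in `Models/CerfonFreidbergIterLikeQ25Sound.lean`.  MODELLED: analytic Cerfon–Freidberg family; `q` of a
MODEL surface — nothing about a device or stability.  No `native_decide`.  Typer/prover: gridfusion-model-5 (g8), 2026-08-27.
Citations: Freidberg 2014 §6.3.5 (6.35) [Freidberg2014]; Mahboubi–Melquiond–Sibut-Pinote 2016 §3.2 Lemma 3 [MahboubiMelquiondSibutpinote2016].
-/

namespace Summit.Ventures.FusionMHD.Models.CFIterLike.Q25

/-- The certificate data of panels 21, 22 (`ψ_N = 1/4`): `inv` candidate (degree-12 fit of `(X·D_r)⁻¹` in the panel variable, scaled by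
`2⁶⁰`), Taylor degree, `inv` widening `2^elog2`, and the claimed integral / residual / `m`-range / `D_r`-range integers (× `2⁶⁰`). [instance data] -/
def panelCert10 : List PanelCert := [
  { j := 21, cand := [17526092634619975680, -17636782859326754816, -124621662707604193280, 942731820061767630848, -983541750365416587264, -18058834645764383178752, 107260745689763911041024, -32276391233107328499712, -2678234653093292905857024, 13476150555796214233694208, 15416635050672000937754624, -244990783371693937173463040, -11448131331683974288907436032],
    deg := 10, elog2 := 38, plo := 394885554257046178, phi := 394885568859890877, eta := 206707595, mlo := 258474000721315295, mhi := 271038709165805289,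
    dlo := 79733780462160155, dhi := 83829579321532461 },
  { j := 22, cand := [16880632949064736768, -22851443700781150208, -46056234224035618816, 704394438418015322112, -2397814428549341773824, -1628719969080262262784, 59262688598648510480384, -283236289381272851054592, 225204259168986777780224, 5135217065468924436414464, -15531925524822388266500096, 12280148951693714826199040, -24542602975067089619726106624],
    deg := 10, elog2 := 38, plo := 362605985320833792, phi := 362605999151071909, eta := 203349129, mlo := 245937954794285561, mhi := 258577737387781058,
    dlo := 83634298301008770, dhi := 88462009182990535 }]

/-- **KERNEL CHECK** of panels 21, 22 of the ITER-like surface `ψ_N = 1/4`. -/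
theorem panelCert10_ok : CFIterLike.Q25.panelCert10.all PanelCert.ok = true := by
  decide +kernel

end Summit.Ventures.FusionMHD.Models.CFIterLike.Q25
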